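import Literature.MathematicalPhysics.QuantumFieldTheory.Balaban1983to89.Beta.BalabanStepJets
import Summits.QuantumFields.BalabanUV.Beta.GradedStencilDictionary

/-!
# `BalabanUV.Beta.D1BFx.WilsonLinearGaugeLattice` — road «BF-x» for binder row D1, letter «LG-E′» part 2: LATTICE CALCULUS FOR THE
# LINEAR-GAUGE WARD IDENTITY — the commutator `[x_κ, d^*d]` on `ℤ^D`, and zero-momentum columns of realised located lists

HONEST DEPENDENCY (page 1, mandatory): continuum YM on T⁴ ⇐ BetaPertH ∧ nine spine estimates (0/9 proved); BetaPertH ⇐ (D1) ∧ (D4) ∧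
CAP+tail; G-an2-4 gates asym, D1 and NE2/3/4.  HONEST FRAMING (cell contract, verbatim): «discharging `BetaPertH` makes Bałaban's UV
stability UNCONDITIONAL — a real constructive-QFT result; it is NOT the continuum limit and NOT the Clay problem.»  THIS MODULE DISCHARGES
NOTHING of the wall: [folklore] finite lattice calculus over an2's `AffineAveraging.curv ∕ curvAdj`, `BalabanStepJets.bondDelta ∕ elCol` and an3's
`GradedStencilDictionary.real ∕ lift`, kernel-checked; no `Prop` minted, no definition, nothing printed asserted, 0 sorry, 0 cited facts.
0 wall binders (root-level hW ∕ hR-sockets ∕ hSX-socket ∕ D1Tel ∕ D1Rep — 0 discharged); (K) NOT closed; NOT D1, NOT `BetaPertH`, NOT continuum, NOT Clay.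

ABSOLUTE RULE (cell charter, verbatim): «No internally-minted statement may enter as a cited fact. Every hypothesis is either kernel-proved in
this package or a verbatim quotation of a PUBLISHED theorem with page reference. The manuscript(s) under audit are NOT citable for their own
disputed steps — they are the thing under adjudication; programme-internal (2001/route/tribunal) claims are never citable.»

WHAT (owner ruling ρ-g9-9, an3 LETTER «LG-E′» (B1); companion of `D1BFx.WilsonLinearGaugeTorus`).
* §1 THE SIGN WORD OF LG-E′ AS LATTICE CALCULUS (every dimension `D`).  Part 1 delivers the linear-gauge Ward identity with right-hand side
  `c_κ(x,α;y,β) − c_κ(y,β;x,α)`, `c_κ(x,α;y,β) = curv(e_{(α,x)})_{κβ}(y − e_κ)` (signed incidence of the bond `(α,x)` in the `(κ,β)`-plaquette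
  based at `y − e_κ`).  an3's letter writes the same number as `−½·(x_κ − y_κ)·elCol β y α x` (`elCol = d^*d e_{(β,y)}` read at `(α,x)`).
  The two agree by the commutator of the coordinate multiplication `x_κ` with `d^*d`: `curv(x_κ·W) = x_κ·curv W + S_κW` (`curv_coordMul`),
  `curvAdj(x_κ·F) = x_κ·curvAdj F + S_κ^†F` (`curvAdj_coordMul`), hence `(x_κ − y_κ)·(d^*d e_q)(p) = 2·curv(e_q)_{κα}(x − e_κ) − curvAdj(S_κ e_q)(p)`
  and `curvAdj(S_κ e_q)(p) = 2·curv(e_p)_{κβ}(y − e_κ)` (`curvAdj_shiftForm`, `curvAdj_shiftForm_bondDelta`):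
  **`curv_bondDelta_sub_eq_elCol`**: `curv(e_{(α,x)})_{κβ}(y − e_κ) − curv(e_{(β,y)})_{κα}(x − e_κ) = −½·(x_κ − y_κ)·elCol β y α x`.
* §2 ZERO-MOMENTUM COLUMNS OF REALISED LISTS (every additive group `Λ`, frame `e`): summing an3's realisation `real e u u V` of a located
  list over the base site `u` (over any finite window holding the row sites) leaves the list's column at fixed leg separation
  (`sum_real_apply`); an additive `π : ℤ⁴ → Λ` composed with the `ℤ⁴` frame lifts to itself (`lift_comp_unitVec`); a uniform bound on
  finitely many `ℤ⁴` vectors exists (`exists_abs_le_of_list`).  Part 3 (`D1BFx.WilsonLinearGauge`) runs the transfer.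
Unit `b2b-balaban-beta-d1-formalise-leaf-04` (gen 8); `LEAVES-BFx.md` row «LG-E′».
-/

open Finset
open scoped BigOperators
open Literature.MathematicalPhysics.QuantumFieldTheory.Balaban1983to89
open Literature.MathematicalPhysics.QuantumFieldTheory.Balaban1983to89.Beta
open AffineAveraging (Site Form1 Form2 unitVec unitVec_apply curv curvAdj)
open BalabanStepJets (bondDelta elCol)
open GradedBubbles (LP Stn)
open BubbleTable (elemIns elemIns_apply)
open Summit.QuantumFields.BalabanUV.Beta.GradedStencilDictionary (lift real real_nil real_cons)

namespace Summit.QuantumFields.BalabanUV.Beta.D1BFx.WilsonLinearGaugeLattice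

/-! ## §1 The commutator of a coordinate with `d^*d`, and the sign word of LG-E′ -/

section Calculus

variable {D : ℕ}

/-- [folklore] A coordinate of a shifted site: `(z + e_k)_κ = z_κ + δ_{kκ}` (cast to `ℝ`). -/
theorem coord_add_unitVec (z : Site D) (k κ : Fin D) :
    (((z + unitVec k) κ : ℤ) : ℝ) = ((z κ : ℤ) : ℝ) + if k = κ then 1 else 0 := by
  simp only [Pi.add_apply, unitVec_apply, Int.cast_add, Int.cast_ite, Int.cast_one, Int.cast_zero]
  by_cases h : k = κ
  · rw [if_pos h, if_pos h.symm]
  · rw [if_neg h, if_neg (Ne.symm h)]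

/-- [folklore] A coordinate of a back-shifted site: `(z − e_k)_κ = z_κ − δ_{kκ}` (cast to `ℝ`). -/
theorem coord_sub_unitVec (z : Site D) (k κ : Fin D) :
    (((z - unitVec k) κ : ℤ) : ℝ) = ((z κ : ℤ) : ℝ) - if k = κ then 1 else 0 := by
  simp only [Pi.sub_apply, unitVec_apply, Int.cast_sub, Int.cast_ite, Int.cast_one, Int.cast_zero]
  by_cases h : k = κ
  · rw [if_pos h, if_pos h.symm]
  · rw [if_neg h, if_neg (Ne.symm h)]

/-- [folklore] **`curv` PAST A COORDINATE MULTIPLICATION**: `curv(x_κ·W)_{kl}(z) = z_κ·curv(W)_{kl}(z) + δ_{kκ}·W_l(z + e_k) − δ_{lκ}·W_k(z + e_l)`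
— the two corners of the plaquette one step up in the `κ`-direction carry the extra unit of coordinate. -/
theorem curv_coordMul (κ : Fin D) (W : Form1 D ℝ) (k l : Fin D) (z : Site D) :
    curv (fun l' z' => ((z' κ : ℤ) : ℝ) * W l' z') k l z =
      ((z κ : ℤ) : ℝ) * curv W k l z + (if k = κ then W l (z + unitVec k) else 0) - (if l = κ then W k (z + unitVec l) else 0) := by
  simp only [curv, coord_add_unitVec]
  by_cases hk : k = κ <;> by_cases hl : l = κ <;> simp only [hk, hl, if_true, if_false] <;> ring

/-- [folklore] **`curvAdj` PAST A COORDINATE MULTIPLICATION**: `curvAdj(x_κ·F)_μ(w) = w_κ·curvAdj(F)_μ(w) + F_{μκ}(w − e_κ) − F_{κμ}(w − e_κ)`. -/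
theorem curvAdj_coordMul (κ : Fin D) (F : Form2 D ℝ) (μ : Fin D) (w : Site D) :
    curvAdj (fun k l z => ((z κ : ℤ) : ℝ) * F k l z) μ w =
      ((w κ : ℤ) : ℝ) * curvAdj F μ w + F μ κ (w - unitVec κ) - F κ μ (w - unitVec κ) := by
  simp only [curvAdj, coord_sub_unitVec, sub_mul, ite_mul, one_mul, zero_mul, Finset.sum_sub_distrib,
    Finset.sum_ite_eq', Finset.mem_univ, if_true, Finset.mul_sum, mul_add, mul_sub]
  ring

/-- [folklore] `curv` is antisymmetric in the direction pair. -/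
theorem curv_swap (W : Form1 D ℝ) (k l : Fin D) (z : Site D) : curv W l k z = -curv W k l z := by
  simp only [curv]
  ring

/-- [folklore] `curvAdj` is additive (pointwise). -/
theorem curvAdj_add_apply (F G : Form2 D ℝ) (μ : Fin D) (w : Site D) : curvAdj (F + G) μ w = curvAdj F μ w + curvAdj G μ w := by
  simp only [curvAdj, Pi.add_apply, Finset.sum_add_distrib, Finset.sum_sub_distrib]
  ring

/-- [folklore] `curvAdj` commutes with a constant scalar (pointwise). -/
theorem curvAdj_constMul_apply (c : ℝ) (F : Form2 D ℝ) (μ : Fin D) (w : Site D) :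
    curvAdj (fun k l z => c * F k l z) μ w = c * curvAdj F μ w := by
  simp only [curvAdj, Finset.mul_sum, mul_add, mul_sub, Finset.sum_sub_distrib]

/-- [folklore] `curv` commutes with a constant scalar. -/
theorem curv_constMul (c : ℝ) (W : Form1 D ℝ) : curv (fun l z => c * W l z) = fun k l z => c * curv W k l z := by
  funext k l z
  simp only [curv]
  ring

/-- [folklore] **THE FORMAL ADJOINT OF THE CORNER TERM**: for `(S_κW)_{kl}(z) := δ_{kκ}·W_l(z + e_k) − δ_{lκ}·W_k(z + e_l)`,
`curvAdj(S_κW)_α(x) = 2·(W_α(x) − W_α(x + e_κ)) + 2·δ_{ακ}·Σ_l (W_l(x + e_κ) − W_l(x + e_κ − e_l))`. -/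
theorem curvAdj_shiftForm (κ : Fin D) (W : Form1 D ℝ) (α : Fin D) (x : Site D) :
    curvAdj (fun k l z => (if k = κ then W l (z + unitVec k) else 0) - (if l = κ then W k (z + unitVec l) else 0)) α x =
      2 * (W α x - W α (x + unitVec κ)) +
        2 * (if α = κ then ∑ l, (W l (x + unitVec κ) - W l (x + unitVec κ - unitVec l)) else 0) := by
  simp only [curvAdj, sub_add_cancel, Finset.sum_sub_distrib, Finset.sum_ite_eq', Finset.mem_univ, if_true]
  by_cases hα : α = κ
  · subst hα
    simp only [if_true]
    have h1 : ∀ l : Fin D, x - unitVec l + unitVec α = x + unitVec α - unitVec l := fun l => by abel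
    simp only [h1]
    ring
  · simp only [hα, if_false, Finset.sum_const_zero]
    ring

/-- [folklore] **THE CORNER TERM OF AN ELEMENTARY FORM IS A PLAQUETTE INCIDENCE**: for `W = e_{(β,y)}`,
`(W_α(x) − W_α(x + e_κ)) + δ_{ακ}·Σ_l (W_l(x + e_κ) − W_l(x + e_κ − e_l)) = curv(e_{(α,x)})_{κβ}(y − e_κ)`. -/
theorem shiftForm_bondDelta (κ α β : Fin D) (x y : Site D) :
    (bondDelta β y α x - bondDelta β y α (x + unitVec κ)) +
        (if α = κ then ∑ l, (bondDelta β y l (x + unitVec κ) - bondDelta β y l (x + unitVec κ - unitVec l)) else 0) =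
      curv (bondDelta α x) κ β (y - unitVec κ) := by
  have e1 : (x + unitVec κ = y) ↔ (y - unitVec κ = x) := by
    constructor
    · intro h; rw [← h]; abel
    · intro h; rw [← h]; abel
  have e2 : (x + unitVec κ - unitVec β = y) ↔ (y - unitVec κ + unitVec β = x) := by
    constructor
    · intro h; rw [← h]; abel
    · intro h; rw [← h]; abel
  have e3 : y - unitVec κ + unitVec κ = y := by abel
  simp only [bondDelta, curv, Finset.sum_sub_distrib, e3]
  have s1 : ∑ l : Fin D, (if l = β ∧ x + unitVec κ = y then (1 : ℝ) else 0) = if x + unitVec κ = y then 1 else 0 := by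
    simp only [ite_and, Finset.sum_ite_eq', Finset.mem_univ, if_true]
  have s2 : ∑ l : Fin D, (if l = β ∧ x + unitVec κ - unitVec l = y then (1 : ℝ) else 0) = if x + unitVec κ - unitVec β = y then 1 else 0 := by
    rw [Finset.sum_eq_single β (fun l _ hl => by rw [if_neg fun h => hl h.1]) (by simp)]
    simp only [true_and]
  rw [s1, s2]
  have exy : (y = x) ↔ (x = y) := eq_comm
  have eβ : (β = α) ↔ (α = β) := eq_comm
  have eκ : (κ = α) ↔ (α = κ) := eq_comm
  simp only [e1, e2, exy, eβ, eκ]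
  by_cases h2 : α = β
  · subst h2
    by_cases h1 : α = κ
    · subst h1
      simp only [true_and, if_true]
      ring
    · simp only [h1, false_and, if_false]
      ring
  · by_cases h1 : α = κ
    · subst h1
      simp only [h2, true_and, false_and, if_true, if_false]
      ring
    · simp only [h1, h2, false_and, if_false]
      ring

/-- [folklore] **THE SIGN WORD OF LG-E′** (every dimension `D`, all directions `κ, α, β`, all sites `x, y`):
`curv(e_{(α,x)})_{κβ}(y − e_κ) − curv(e_{(β,y)})_{κα}(x − e_κ) = −½·(x_κ − y_κ)·elCol β y α x` — the antisymmetrised plaquette incidence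
behind the `κ`-direction IS `−½·[x_κ, d^*d]` read between the bonds `(α,x)` and `(β,y)` (an3's letter «LG-E′», sign `−½`). -/
theorem curv_bondDelta_sub_eq_elCol (κ α β : Fin D) (x y : Site D) :
    curv (bondDelta α x) κ β (y - unitVec κ) - curv (bondDelta β y) κ α (x - unitVec κ) =
      -(1 / 2 : ℝ) * (((x κ : ℤ) : ℝ) - ((y κ : ℤ) : ℝ)) * elCol β y α x := by
  set W : Form1 D ℝ := bondDelta β y with hW
  -- `x_κ·W = y_κ·W` for the elementary form at `(β, y)`
  have hπ : (fun l z => ((z κ : ℤ) : ℝ) * W l z) = fun l z => ((y κ : ℤ) : ℝ) * W l z := by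
    funext l z
    simp only [hW, bondDelta]
    by_cases h : l = β ∧ z = y
    · rw [if_pos h, h.2]
    · rw [if_neg h, mul_zero, mul_zero]
  -- the corner decomposition of `curv(x_κ·W)`
  have hdec : curv (fun l z => ((z κ : ℤ) : ℝ) * W l z) =
      (fun k l z => ((z κ : ℤ) : ℝ) * curv W k l z) +
        fun k l z => (if k = κ then W l (z + unitVec k) else 0) - (if l = κ then W k (z + unitVec l) else 0) := by
    funext k l z
    rw [curv_coordMul, Pi.add_apply, Pi.add_apply, Pi.add_apply]
    ring
  -- read `curvAdj` of both sides at `(α, x)`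
  have h1 : curvAdj (curv (fun l z => ((z κ : ℤ) : ℝ) * W l z)) α x = ((y κ : ℤ) : ℝ) * elCol β y α x := by
    rw [hπ, curv_constMul, curvAdj_constMul_apply]
    rfl
  have h2 : curvAdj (curv (fun l z => ((z κ : ℤ) : ℝ) * W l z)) α x =
      ((x κ : ℤ) : ℝ) * elCol β y α x + curv W α κ (x - unitVec κ) - curv W κ α (x - unitVec κ) +
        (2 * (W α x - W α (x + unitVec κ)) +
          2 * (if α = κ then ∑ l, (W l (x + unitVec κ) - W l (x + unitVec κ - unitVec l)) else 0)) := by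
    rw [hdec, curvAdj_add_apply, curvAdj_coordMul, curvAdj_shiftForm]
    rfl
  have h3 := shiftForm_bondDelta κ α β x y
  rw [curv_swap W κ α] at h2
  rw [← hW] at h3
  linear_combination (1 / 2 : ℝ) * h1 - (1 / 2 : ℝ) * h2 - h3

end Calculus

/-! ## §2 Zero-momentum columns of realised located lists -/

section Columns

variable {Λ : Type*} [DecidableEq Λ] [AddCommGroup Λ] {I : Type*}

/-- [folklore] **THE ZERO-MOMENTUM COLUMN OF A REALISED LIST**: summing an3's realisation `real e u u V` over the base site `u` (over any finite
window `U` holding every row site `x − lift e p.x`) at fixed legs `(x, a)`, `(z, b)` gives the column of the list at separation `z − x`: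
`Σ_{u ∈ U} real e u u V (x,a) (z,b) = Σ_{p ∈ V} [z − x = lift e p.y − lift e p.x]·p.m a b`. -/
theorem sum_real_apply (e : Fin 4 → Λ) (V : Stn I) (x z : Λ) (a b : I) (U : Finset Λ) (hU : ∀ p ∈ V, x - lift e p.x ∈ U) :
    ∑ u ∈ U, real e u u V (x, a) (z, b) = (V.map fun p => if z - x = lift e p.y - lift e p.x then p.m a b else 0).sum := by
  induction V with
  | nil => simp only [real_nil, Matrix.zero_apply, Finset.sum_const_zero, List.map_nil, List.sum_nil]
  | cons p V ih =>
    rw [List.map_cons, List.sum_cons, ← ih fun q hq => hU q (List.mem_cons_of_mem p hq)]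
    simp only [real_cons, Matrix.add_apply, Finset.sum_add_distrib, elemIns_apply]
    congr 1
    have hc : ∀ u : Λ, (x = u + lift e p.x ∧ z = u + lift e p.y) ↔ (u = x - lift e p.x ∧ z - x = lift e p.y - lift e p.x) := by
      intro u
      constructor
      · rintro ⟨h1, h2⟩
        refine ⟨?_, ?_⟩
        · rw [h1]; abel
        · rw [h1, h2]; abel
      · rintro ⟨h1, h2⟩
        refine ⟨?_, ?_⟩
        · rw [h1]; abel
        · have : z = z - x + x := by abel
          rw [this, h2, h1]; abel
    simp only [hc, ite_and]
    rw [Finset.sum_ite_eq' U (x - lift e p.x)]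
    rw [if_pos (hU p (List.mem_cons_self))]

omit [DecidableEq Λ] in
/-- [folklore] **AN ADDITIVE MAP COMPOSED WITH THE `ℤ⁴` FRAME LIFTS TO ITSELF**: `lift (π ∘ e₀) w = π w` for an2's frame
`e₀ = B6BondElimination.unitVec`. -/
theorem lift_comp_unitVec (π : (Fin 4 → ℤ) →+ Λ) (w : Fin 4 → ℤ) :
    lift (fun i => π (B6BondElimination.unitVec (d := 4) i)) w = π w := by
  unfold lift
  have h : w = ∑ i : Fin 4, w i • B6BondElimination.unitVec (d := 4) i := by
    funext j
    rw [Finset.sum_apply]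
    simp only [Pi.smul_apply, B6BondElimination.unitVec, smul_eq_mul, mul_ite, mul_one, mul_zero, Finset.sum_ite_eq,
      Finset.mem_univ, if_true]
  conv_rhs => rw [h, map_sum]
  simp only [map_zsmul]

/-- [folklore] Finitely many `ℤ⁴` vectors are uniformly bounded. -/
theorem exists_abs_le_of_list (V : Stn I) (f : LP I → Fin 4 → ℤ) : ∃ B : ℕ, ∀ p ∈ V, ∀ i, |f p i| ≤ (B : ℤ) := by
  induction V with
  | nil => exact ⟨0, fun p hp => absurd hp List.not_mem_nil⟩
  | cons q V ih =>
    obtain ⟨B, hB⟩ := ih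
    refine ⟨B + ∑ i, (f q i).natAbs, fun p hp i => ?_⟩
    push_cast
    have h0 : (0 : ℤ) ≤ ∑ j, |f q j| := Finset.sum_nonneg fun j _ => abs_nonneg _
    rcases List.mem_cons.mp hp with h | h
    · subst h
      have h2 : |f p i| ≤ ∑ j, |f p j| := Finset.single_le_sum (f := fun j => |f p j|) (fun j _ => abs_nonneg _) (Finset.mem_univ i)
      have hB0 : (0 : ℤ) ≤ B := Int.natCast_nonneg B
      linarith
    · have := hB p h i
      linarith

end Columns

end Summit.QuantumFields.BalabanUV.Beta.D1BFx.WilsonLinearGaugeLattice
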